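import Literature.MathematicalPhysics.QuantumLattice.TorusCooperSumLogBound
import Literature.MathematicalPhysics.QuantumLattice.ReducedBCSTorus

/-!
# `TwTipContinuation` (stmt-HubbardSuperconductivity-1700), line `isogap-submodular-transport`,
# stub `stub_edgeOrder` — piece 4(i): parity and the `(π,π)` shift of the square-lattice band

Elementary trigonometry on the momentum grid `(ℤ/Lℤ)²` of the fermionic torus, for the d-wave
BCS trial state and the Cooper logarithm:
* `cos(2π·(−k)ᵢ/L) = cos(2π kᵢ/L)`, hence `ε_L(−k) = ε_L(k)` and `ĝ_d(−k) = ĝ_d(k)`;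
* for EVEN `L`, the shift by `Q = (L/2, L/2)` (momentum `(π,π)`) flips both:
  `ε_L(k+Q) = −ε_L(k)`, `ĝ_d(k+Q) = −ĝ_d(k)`; hence every grid sum of a function of
  `(ε_L(k) − μ)²` and `ĝ_d(k)²` is even in `μ` (`sum_shift_symm`);
* the discrete intermediate-value count of rows `b` with `cos(2πb/L)` in a prescribed window
  `[a, a + s²/8] ⊂ [−1 + s²/8, 1]` (`card_windowRows_ge`, the intermediate step of the tree's
  `card_cooperGoodRows_ge`, stated for an arbitrary window).
Folklore.
-/

noncomputable section

namespace Summit.HubbardSuperconductivity.TwTipContinuation.IsogapTransport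

open Finset Real
open Literature.MathematicalPhysics.QuantumLattice Literature.Probability.LatticeModels

/-! ### Periodicity bookkeeping -/

/-- `cos(2π (m mod L)/L) = cos(2π m/L)`. [folklore] -/
theorem cos_two_pi_mod (L m : ℕ) (hL : 0 < L) :
    Real.cos (2 * π * ((m % L : ℕ) : ℝ) / L) = Real.cos (2 * π * (m : ℝ) / L) := by
  have hLr : (L : ℝ) ≠ 0 := by exact_mod_cast hL.ne'
  have hm : ((m % L : ℕ) : ℝ) = m - L * (m / L : ℕ) := by
    have := Nat.div_add_mod m L
    have h : ((L * (m / L) + m % L : ℕ) : ℝ) = m := by exact_mod_cast this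
    push_cast at h
    linarith
  rw [hm, show 2 * π * ((m : ℝ) - L * ((m / L : ℕ) : ℝ)) / L = 2 * π * (m : ℝ) / L - ((m / L : ℕ) : ℝ) * (2 * π) by
    field_simp, Real.cos_sub_nat_mul_two_pi]

variable {L : ℕ} [NeZero L]

/-- `cos` of the lattice momentum is even under `k ↦ −k`. [folklore] -/
theorem cos_latticeMomentum_neg (k : TorusSite 2 L) (i : Fin 2) :
    Real.cos (latticeMomentum L (-k) i) = Real.cos (latticeMomentum L k i) := by
  have hL : 0 < L := Nat.pos_of_ne_zero (NeZero.ne L)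
  have hLr : (L : ℝ) ≠ 0 := by exact_mod_cast hL.ne'
  simp only [latticeMomentum, Pi.neg_apply]
  rw [ZMod.neg_val', cos_two_pi_mod L _ hL]
  have hv : (k i).val ≤ L := (ZMod.val_lt (k i)).le
  rw [Nat.cast_sub hv, show 2 * π * ((L : ℝ) - ((k i).val : ℝ)) / L = (1 : ℕ) * (2 * π) - 2 * π * ((k i).val : ℝ) / L by
    push_cast; field_simp, Real.cos_nat_mul_two_pi_sub]

/-- `ε_L(−k) = ε_L(k)`. [folklore] -/
theorem torusBand_neg (k : TorusSite 2 L) : torusBand L (-k) = torusBand L k := by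
  simp only [torusBand, cos_latticeMomentum_neg]

/-- `ĝ_d(−k) = ĝ_d(k)`. [folklore] -/
theorem dWaveGap_neg (k : TorusSite 2 L) : dWaveGap (-k) = dWaveGap k := by
  simp only [dWaveGap, cos_latticeMomentum_neg]

/-- For even `L`, shifting a momentum label by `L/2` shifts the lattice momentum by `π`:
`cos(2π (kᵢ + L/2)/L) = −cos(2π kᵢ/L)`. [folklore] -/
theorem cos_latticeMomentum_add_half (hE : Even L) (k : TorusSite 2 L) (i : Fin 2) :
    Real.cos (latticeMomentum L (k + fun _ => ((L / 2 : ℕ) : ZMod L)) i) = -Real.cos (latticeMomentum L k i) := by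
  have hL : 0 < L := Nat.pos_of_ne_zero (NeZero.ne L)
  have hLr : (L : ℝ) ≠ 0 := by exact_mod_cast hL.ne'
  obtain ⟨r, hr⟩ := hE
  have hhalf : L / 2 = r := by omega
  simp only [latticeMomentum, Pi.add_apply]
  rw [ZMod.val_add, ZMod.val_natCast, Nat.mod_eq_of_lt (show L / 2 < L by omega), cos_two_pi_mod L _ hL,
    Nat.cast_add, hhalf]
  have : 2 * π * (((k i).val : ℝ) + (r : ℝ)) / L = 2 * π * ((k i).val : ℝ) / L + π := by
    have hLr' : (L : ℝ) = r + r := by exact_mod_cast hr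
    field_simp
    rw [hLr']
    ring
  rw [this, Real.cos_add_pi]

/-- `ε_L(k + Q) = −ε_L(k)` for the `(π,π)` shift `Q = (L/2, L/2)`, `L` even. [folklore] -/
theorem torusBand_add_half (hE : Even L) (k : TorusSite 2 L) :
    torusBand L (k + fun _ => ((L / 2 : ℕ) : ZMod L)) = -torusBand L k := by
  simp only [torusBand, cos_latticeMomentum_add_half hE, Finset.sum_neg_distrib, mul_neg]

/-- `ĝ_d(k + Q) = −ĝ_d(k)` for the `(π,π)` shift, `L` even. [folklore] -/
theorem dWaveGap_add_half (hE : Even L) (k : TorusSite 2 L) :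
    dWaveGap (k + fun _ => ((L / 2 : ℕ) : ZMod L)) = -dWaveGap k := by
  simp only [dWaveGap, cos_latticeMomentum_add_half hE]
  ring

/-- **Particle–hole symmetry of grid sums**: for even `L` and any `F`,
`Σ_k F((ε_L(k) − μ)², ĝ_d(k)²) = Σ_k F((ε_L(k) + μ)², ĝ_d(k)²)`. [folklore] -/
theorem sum_shift_symm (hE : Even L) (F : ℝ → ℝ → ℝ) (μ : ℝ) :
    ∑ k : TorusSite 2 L, F ((torusBand L k - μ) ^ 2) (dWaveGap k ^ 2) =
      ∑ k : TorusSite 2 L, F ((torusBand L k + μ) ^ 2) (dWaveGap k ^ 2) := by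
  rw [← Equiv.sum_comp (Equiv.addRight (fun _ : Fin 2 => ((L / 2 : ℕ) : ZMod L))) _]
  refine Finset.sum_congr rfl fun k _ => ?_
  simp only [Equiv.coe_addRight, torusBand_add_half hE, dWaveGap_add_half hE]
  congr 1 <;> ring

/-- `|ĝ_d(k)| ≤ 2`. [folklore] -/
theorem abs_dWaveGap_le {L : ℕ} (k : TorusSite 2 L) : |dWaveGap k| ≤ 2 := by
  unfold dWaveGap
  have h1 := Real.abs_cos_le_one (latticeMomentum L k 0)
  have h2 := Real.abs_cos_le_one (latticeMomentum L k 1)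
  calc |Real.cos (latticeMomentum L k 0) - Real.cos (latticeMomentum L k 1)|
      ≤ |Real.cos (latticeMomentum L k 0)| + |Real.cos (latticeMomentum L k 1)| := abs_sub _ _
    _ ≤ 2 := by linarith

/-! ### Rows of the grid in a window of `cos` values -/

/-- **Window rows.** For `0 < s ≤ 1`, `L ≥ 400/s²` and a window `[a, a + s²/8]` with
`−1 + s²/8 ≤ a`, `a + s²/8 ≤ 1`, at least `s²L/(32π)` row labels `n ≤ L/2` have
`cos(2πn/L) ∈ [a, a + s²/8]` (the antitone sequence `cos(2πn/L)` has steps `≤ 2π/L`). [folklore] -/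
theorem card_windowRows_ge {L : ℕ} {s a : ℝ} (hs : 0 < s) (hs1 : s ≤ 1) (hL : 400 / s ^ 2 ≤ (L : ℝ))
    (ha1 : -1 + s ^ 2 / 8 ≤ a) (ha2 : a + s ^ 2 / 8 ≤ 1) :
    s ^ 2 * L / (32 * π) ≤
      (((Finset.range (L / 2 + 1)).filter fun n : ℕ =>
          a ≤ Real.cos (2 * π * (n : ℝ) / L) ∧ Real.cos (2 * π * (n : ℝ) / L) ≤ a + s ^ 2 / 8).card : ℝ) := by
  have hπ := Real.pi_pos
  have hπ3 := Real.pi_gt_three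
  have hs2 : 0 < s ^ 2 := by positivity
  have hsL : 400 ≤ s ^ 2 * L := by rwa [div_le_iff₀ hs2, mul_comm] at hL
  have hLr : (0 : ℝ) < L := by nlinarith
  have hL1 : (1 : ℝ) ≤ L := by nlinarith
  set m : ℕ := L / 2 with hm
  have hstep : ∀ n < m, |Real.cos (2 * π * ((n + 1 : ℕ) : ℝ) / L) -
      Real.cos (2 * π * (n : ℝ) / L)| ≤ 2 * π / L := by
    intro n _
    have h := Real.abs_cos_sub_cos_le (2 * π * ((n + 1 : ℕ) : ℝ) / L) (2 * π * (n : ℝ) / L)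
    rwa [show 2 * π * ((n + 1 : ℕ) : ℝ) / L - 2 * π * (n : ℝ) / L = 2 * π / L by push_cast; ring,
      abs_of_pos (show (0 : ℝ) < 2 * π / L by positivity)] at h
  have hxm : Real.cos (2 * π * (m : ℝ) / L) < a := by
    obtain ⟨r, hr, hLmr⟩ : ∃ r : ℕ, r ≤ 1 ∧ L = 2 * m + r := ⟨L % 2, by omega, by omega⟩
    have hangle : 2 * π * (m : ℝ) / L = π - π * r / L := by
      have : (L : ℝ) = 2 * m + r := by exact_mod_cast hLmr
      field_simp
      rw [this]
      ring
    rw [hangle, Real.cos_pi_sub]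
    have h1 : Real.cos (π / L) ≤ Real.cos (π * r / L) := by
      apply Real.cos_le_cos_of_nonneg_of_le_pi (by positivity)
      · rw [div_le_iff₀ hLr]; nlinarith
      · have : (r : ℝ) ≤ 1 := by exact_mod_cast hr
        rw [div_le_div_iff_of_pos_right hLr]
        nlinarith
    have h2 := Real.one_sub_sq_div_two_le_cos (x := π / L)
    have h3 : (π / L) ^ 2 < s ^ 2 / 4 := by
      rw [div_pow, div_lt_iff₀ (by positivity)]
      have hπ10 : π ^ 2 < 10 := by nlinarith [Real.pi_lt_d2]
      have : π ^ 2 < s ^ 2 / 4 * L := by nlinarith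
      nlinarith
    linarith
  have hx0 : a + s ^ 2 / 8 ≤ Real.cos (2 * π * ((0 : ℕ) : ℝ) / L) := by
    simp only [Nat.cast_zero, mul_zero, zero_div, Real.cos_zero]
    exact ha2
  have hcount := sub_one_le_card_filter_mem_Icc (x := fun n : ℕ => Real.cos (2 * π * (n : ℝ) / L))
    (by positivity : (0 : ℝ) < 2 * π / L) (by positivity : (0 : ℝ) ≤ s ^ 2 / 8) hstep hxm hx0
  have e : s ^ 2 / 8 / (2 * π / L) = s ^ 2 * L / (16 * π) := by field_simp; ring
  calc s ^ 2 * L / (32 * π) ≤ s ^ 2 * L / (16 * π) - 1 := by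
        have h32 : 1 ≤ s ^ 2 * L / (32 * π) := by
          rw [le_div_iff₀ (by positivity)]
          nlinarith [Real.pi_lt_d2]
        have e2 : s ^ 2 * L / (16 * π) = 2 * (s ^ 2 * L / (32 * π)) := by field_simp; ring
        linarith
    _ = s ^ 2 / 8 / (2 * π / L) - 1 := by rw [e]
    _ ≤ _ := hcount

/-- **Window rows (piece 4(i) of `stub_edgeOrder`)**, closed form. [folklore] -/
theorem torus_windowRows_count :
    ∀ (L : ℕ) (s a : ℝ), 0 < s → s ≤ 1 → 400 / s ^ 2 ≤ (L : ℝ) → -1 + s ^ 2 / 8 ≤ a → a + s ^ 2 / 8 ≤ 1 → s ^ 2 * L / (32 * Real.pi) ≤ (((Finset.range (L / 2 + 1)).filter fun n : ℕ => a ≤ Real.cos (2 * Real.pi * (n : ℝ) / L) ∧ Real.cos (2 * Real.pi * (n : ℝ) / L) ≤ a + s ^ 2 / 8).card : ℝ) :=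
  fun _ _ _ hs hs1 hL ha1 ha2 => card_windowRows_ge hs hs1 hL ha1 ha2

end Summit.HubbardSuperconductivity.TwTipContinuation.IsogapTransport
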